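import Literature.MathematicalPhysics.QuantumLattice.GrassmannIntegrationByParts
import Literature.MathematicalPhysics.QuantumLattice.HubbardEffectiveAction
import Literature.MathematicalPhysics.QuantumLattice.MatsubaraTruncationMidpoint
import HarnessLib

/-!
# The truncated Hartree term of the Hubbard vertex: the symmetric Matsubara truncation realises `U(n↑−½)(n↓−½)`

Topic `Literature/MathematicalPhysics/QuantumLattice`.  For the tree's Grassmann representation of the seeded Hubbard
torus — fields `ψ̂^±_{kσ}` on the SYMMETRIC frequency set `ω_n = π(2n+1)/β`, `n ∈ [−M, M)` (`HubbardFreeCovariance.lean`),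
free covariance `hubbardCovariance L M β μ h` (Nambu propagator `G = (−iω + M(k⃗))⁻¹`, BGM 2006 (2.2)–(2.3), no
convergence factor `e^{iω0⁺}`), and the PLAIN quartic vertex
`hubbardInteraction L M β U = U(βL²)⁻³ Σ_{k₁+k₃=k₂+k₄} ψ̂⁺_{k₁↑}ψ̂⁻_{k₂↑}ψ̂⁺_{k₃↓}ψ̂⁻_{k₄↓}` (BGM 2006 (2.6a),
`HubbardEffectiveAction.lean`) — we EVALUATE the first-order (Hartree–Fock) term `∫ dμ_C V` with the four-point Wick rule
of `GrassmannIntegrationByParts.lean`: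

* `gaussExpect_vertexMonomial`, `gaussExpect_vertexMonomial_ite` — one vertex monomial: Hartree pairing of each spin and
  the anomalous `F F̄` pairing, the opposite-spin normal pairing vanishing; the momentum–frequency constraint is automatic
  on both pairings (`n(−k) = −n(k) − 1`);
* **`gaussExpect_hubbardInteraction`** — for every seed `h`:
  `∫ dμ_C V = U(βL²)⁻¹ [ (Σ_k G₁₁(k))(−Σ_k G₂₂(k)) + (Σ_k G₂₁(k))(Σ_k G₁₂(k)) ]`;
* `sum_nambuPropagator_11` (`Σ_k G₂₂ = −Σ_k G₁₁`, reflection `ω ↦ −ω`), `gaussExpect_hubbardInteraction_zero_seed`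
  (`h = 0`: `∫ dμ_C V = U(βL²)⁻¹ (Σ_k 1/(−iω_k + ξ_k))²`);
* **`tendsto_gaussExpect_hubbardInteraction_zero_seed`** — as `M → ∞` (`β > 0`, `h = 0`):
  `(βL²)⁻¹ ∫ dμ_{C_M} V ⟶ U · (L⁻² Σ_{k⃗} (½ − n_F(ξ_{k⃗})))²`,
  by the midpoint lemma `tendsto_truncatedTadpole_bgm` (`(1/β)Σ_ω 1/(−iω+ξ) → ½ − n_F(ξ)`, `MatsubaraTruncationMidpoint.lean`).

CONSEQUENCE (the point of the file).  The first-order free energy of the truncated Grassmann model is the free-state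
Hartree energy of the SYMMETRISED interaction `U Σ_x (n_{x↑} − ½)(n_{x↓} − ½)` — `U(n − ½)²` per site, `n = L⁻²Σ_{k⃗} n_F(ξ_{k⃗})`
the free density per spin — and not that of `U Σ_x n_{x↑} n_{x↓}` (`U n²` per site): with this truncation the plain quartic
vertex at chemical potential `μ` represents the Hubbard Hamiltonian `hubbardTorusWith 2 L 1 U (μ + U/2)` (Giuliani–Mastropietro
2010, remark after (2.6a) and App. A (A.19)–(A.21): "the correct choice of the interaction expressed in Grassmann variables does
not include terms bilinear in the fields, contrary to the interaction in second quantized form").  Nothing about the operator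
model is asserted here; the comparison value `U n²` is the standard Wick factorisation of the free Gibbs state.

Everything is proved; no definition is introduced.

## Sources

A. Giuliani, V. Mastropietro, Commun. Math. Phys. 293 (2010) 301–346, §2 (2.6)–(2.6a), App. A (A.19)–(A.21)
[`GiulianiMastropietro2010`]; G. Benfatto, A. Giuliani, V. Mastropietro, Ann. Henri Poincaré 7 (2006) 809, §2.1 (2.1)–(2.8)
[`BenfattoGiulianiMastropietro2006`]; J. Feldman, H. Knörrer, E. Trubowitz, *Fermionic Functional Integrals and the
Renormalization Group* (2002), §I.2 [`FeldmanKnorrerTrubowitz2002`]. [folklore]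
-/

noncomputable section

namespace Literature.MathematicalPhysics.QuantumLattice

open GrassmannAlgebra

/-! ## The truncated Hartree term of `hubbardInteraction` -/

section TruncatedHartree

open Finset Filter Literature.Probability.LatticeModels
open scoped Topology

variable {L M : ℕ}

/-! ### Re-indexing by `k ↦ -k` -/

/-- `k ↦ k.neg` is injective (an involution). [folklore] -/
theorem FreqMomentum.neg_inj {k k' : FreqMomentum L M} : k.neg = k'.neg ↔ k = k' :=
  ⟨fun hk => by rw [← FreqMomentum.neg_neg k, hk, FreqMomentum.neg_neg], fun hk => by rw [hk]⟩

/-- Momentum–frequency conservation holds on the Hartree pairing `k₂ = k₁`, `k₄ = k₃`. [folklore] -/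
theorem vertexConstraint_of_hartree (k₁ k₃ : FreqMomentum L M) :
    matsubaraInt M k₁.1 + matsubaraInt M k₃.1 = matsubaraInt M k₁.1 + matsubaraInt M k₃.1 ∧ k₁.2 + k₃.2 = k₁.2 + k₃.2 :=
  ⟨rfl, rfl⟩

/-- Momentum–frequency conservation holds on the anomalous pairing `k₁ = -k₃`, `k₂ = -k₄`
(`n(-k) = -n(k) - 1` on the integer labels). [folklore] -/
theorem vertexConstraint_of_anomalous (k₃ k₄ : FreqMomentum L M) :
    matsubaraInt M k₃.neg.1 + matsubaraInt M k₃.1 = matsubaraInt M k₄.neg.1 + matsubaraInt M k₄.1 ∧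
      k₃.neg.2 + k₃.2 = k₄.neg.2 + k₄.2 := by
  refine ⟨?_, ?_⟩
  · simp only [FreqMomentum.neg, matsubaraInt_rev]; ring
  · simp only [FreqMomentum.neg, neg_add_cancel]

variable [NeZero L]

/-- Re-indexing a sum by `k ↦ -k`. [folklore] -/
theorem sum_freqMomentum_neg {α : Type*} [AddCommMonoid α] (f : FreqMomentum L M → α) :
    ∑ k : FreqMomentum L M, f k.neg = ∑ k : FreqMomentum L M, f k :=
  Fintype.sum_equiv (Function.Involutive.toPerm _ FreqMomentum.neg_neg) _ _ fun _ => rfl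

/-- A Kronecker sum against `-k`: `Σ_{k'} δ_{k,-k'} a = a`. [folklore] -/
theorem sum_ite_eq_neg {α : Type*} [AddCommMonoid α] (k : FreqMomentum L M) (a : α) :
    ∑ k' : FreqMomentum L M, (if k = k'.neg then a else 0) = a := by
  classical
  rw [← sum_freqMomentum_neg (fun k' => if k = k'.neg then a else 0)]
  simp only [FreqMomentum.neg_neg, Finset.sum_ite_eq, Finset.mem_univ, if_true]

variable (β μ h : ℝ)

/-! ### The free two-point table on the vertex legs -/

/-- `⟨ψ̂⁺_{k↑} ψ̂⁻_{k'↑}⟩₀ = -βL² δ_{kk'} G₁₁(k)`. [cite: BenfattoGiulianiMastropietro2006, §2.1 (2.3)] -/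
theorem gaussExpect_psiPlus_up_psiMinus_up (k k' : FreqMomentum L M) :
    gaussExpect ℂ (hubbardCovariance L M β μ h) (psiPlus k 0 * psiMinus k' 0) =
      if k = k' then -(((β * (L : ℝ) ^ 2 : ℝ) : ℂ) * nambuPropagator L M β μ h k 0 0) else 0 := by
  rw [psiMinus, psiPlus, gaussExpect_hubbardCovariance_gen_mul_gen, hubbardTwoPoint]
  by_cases hk : k = k'
  · subst hk; simp [toNambu, nambuTwoPoint]
  · simp [toNambu, nambuTwoPoint, hk, Ne.symm hk]

/-- `⟨ψ̂⁺_{k↓} ψ̂⁻_{k'↓}⟩₀ = βL² δ_{kk'} G₂₂(-k)`. [cite: BenfattoGiulianiMastropietro2006, §2.1 (2.3)] -/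
theorem gaussExpect_psiPlus_down_psiMinus_down (k k' : FreqMomentum L M) :
    gaussExpect ℂ (hubbardCovariance L M β μ h) (psiPlus k 1 * psiMinus k' 1) =
      if k = k' then ((β * (L : ℝ) ^ 2 : ℝ) : ℂ) * nambuPropagator L M β μ h k.neg 1 1 else 0 := by
  rw [psiMinus, psiPlus, gaussExpect_hubbardCovariance_gen_mul_gen, hubbardTwoPoint]
  by_cases hk : k = k'
  · subst hk; simp [toNambu, nambuTwoPoint]
  · have hk' : k.neg ≠ k'.neg := fun h' => hk (FreqMomentum.neg_inj.1 h')
    simp [toNambu, nambuTwoPoint, hk, hk', Ne.symm hk']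

/-- Anomalous: `⟨ψ̂⁺_{k↑} ψ̂⁺_{k'↓}⟩₀ = -βL² δ_{k,-k'} G₂₁(k)`. [folklore] -/
theorem gaussExpect_psiPlus_up_psiPlus_down (k k' : FreqMomentum L M) :
    gaussExpect ℂ (hubbardCovariance L M β μ h) (psiPlus k 0 * psiPlus k' 1) =
      if k = k'.neg then -(((β * (L : ℝ) ^ 2 : ℝ) : ℂ) * nambuPropagator L M β μ h k 1 0) else 0 := by
  rw [psiPlus, psiPlus, gaussExpect_hubbardCovariance_gen_mul_gen, hubbardTwoPoint]
  by_cases hk : k = k'.neg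
  · subst hk; simp [toNambu, nambuTwoPoint]
  · simp [toNambu, nambuTwoPoint, hk, Ne.symm hk]

/-- Anomalous: `⟨ψ̂⁻_{k↑} ψ̂⁻_{k'↓}⟩₀ = βL² δ_{k,-k'} G₁₂(k)`. [folklore] -/
theorem gaussExpect_psiMinus_up_psiMinus_down (k k' : FreqMomentum L M) :
    gaussExpect ℂ (hubbardCovariance L M β μ h) (psiMinus k 0 * psiMinus k' 1) =
      if k = k'.neg then ((β * (L : ℝ) ^ 2 : ℝ) : ℂ) * nambuPropagator L M β μ h k 0 1 else 0 := by
  rw [psiMinus, psiMinus, gaussExpect_hubbardCovariance_gen_mul_gen, hubbardTwoPoint]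
  by_cases hk : k = k'.neg
  · subst hk; simp [toNambu, nambuTwoPoint]
  · simp [toNambu, nambuTwoPoint, hk, Ne.symm hk]

/-- Opposite spins, normal order: `⟨ψ̂⁺_{k↑} ψ̂⁻_{k'↓}⟩₀ = 0`. [folklore] -/
theorem gaussExpect_psiPlus_up_psiMinus_down (k k' : FreqMomentum L M) :
    gaussExpect ℂ (hubbardCovariance L M β μ h) (psiPlus k 0 * psiMinus k' 1) = 0 := by
  rw [psiPlus, psiMinus, gaussExpect_hubbardCovariance_gen_mul_gen, hubbardTwoPoint]
  simp [toNambu, nambuTwoPoint]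

/-- Opposite spins: `⟨ψ̂⁻_{k↑} ψ̂⁺_{k'↓}⟩₀ = 0`. [folklore] -/
theorem gaussExpect_psiMinus_up_psiPlus_down (k k' : FreqMomentum L M) :
    gaussExpect ℂ (hubbardCovariance L M β μ h) (psiMinus k 0 * psiPlus k' 1) = 0 := by
  rw [psiPlus, psiMinus, gaussExpect_hubbardCovariance_gen_mul_gen, hubbardTwoPoint]
  simp [toNambu, nambuTwoPoint]

/-- **Wick evaluation of one vertex monomial**: `⟨ψ̂⁺_{k₁↑}ψ̂⁻_{k₂↑}ψ̂⁺_{k₃↓}ψ̂⁻_{k₄↓}⟩₀ =`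
`(βL²)² [ -δ_{k₁k₂}δ_{k₃k₄} G₁₁(k₁) G₂₂(-k₃) + δ_{k₁,-k₃}δ_{k₂,-k₄} G₂₁(k₁) G₁₂(k₂) ]`
(Hartree + anomalous pairings; the opposite-spin normal pairing vanishes). [folklore] -/
theorem gaussExpect_vertexMonomial (k₁ k₂ k₃ k₄ : FreqMomentum L M) :
    gaussExpect ℂ (hubbardCovariance L M β μ h) (psiPlus k₁ 0 * psiMinus k₂ 0 * psiPlus k₃ 1 * psiMinus k₄ 1) =
      (if k₁ = k₂ then -(((β * (L : ℝ) ^ 2 : ℝ) : ℂ) * nambuPropagator L M β μ h k₁ 0 0) else 0) *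
          (if k₃ = k₄ then ((β * (L : ℝ) ^ 2 : ℝ) : ℂ) * nambuPropagator L M β μ h k₃.neg 1 1 else 0) -
        (if k₁ = k₃.neg then -(((β * (L : ℝ) ^ 2 : ℝ) : ℂ) * nambuPropagator L M β μ h k₁ 1 0) else 0) *
          (if k₂ = k₄.neg then ((β * (L : ℝ) ^ 2 : ℝ) : ℂ) * nambuPropagator L M β μ h k₂ 0 1 else 0) := by
  rw [psiPlus, psiMinus, psiPlus, psiMinus, gaussExpect_gen_mul_gen_mul_gen_mul_gen]
  rw [← psiPlus, ← psiMinus, ← psiPlus, ← psiMinus, gaussExpect_psiPlus_up_psiMinus_up,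
    gaussExpect_psiPlus_down_psiMinus_down, gaussExpect_psiPlus_up_psiPlus_down, gaussExpect_psiMinus_up_psiMinus_down,
    gaussExpect_psiPlus_up_psiMinus_down, zero_mul, add_zero]

/-- The constrained vertex sum may be replaced by the unconstrained one: off the two Wick pairings the Gaussian
value of the monomial vanishes, and on them momentum–frequency conservation holds. [folklore] -/
theorem gaussExpect_vertexMonomial_ite (k₁ k₂ k₃ k₄ : FreqMomentum L M) :
    gaussExpect ℂ (hubbardCovariance L M β μ h)
        (if matsubaraInt M k₁.1 + matsubaraInt M k₃.1 = matsubaraInt M k₂.1 + matsubaraInt M k₄.1 ∧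
            k₁.2 + k₃.2 = k₂.2 + k₄.2 then psiPlus k₁ 0 * psiMinus k₂ 0 * psiPlus k₃ 1 * psiMinus k₄ 1 else 0) =
      (if k₁ = k₂ then -(((β * (L : ℝ) ^ 2 : ℝ) : ℂ) * nambuPropagator L M β μ h k₁ 0 0) else 0) *
          (if k₃ = k₄ then ((β * (L : ℝ) ^ 2 : ℝ) : ℂ) * nambuPropagator L M β μ h k₃.neg 1 1 else 0) -
        (if k₁ = k₃.neg then -(((β * (L : ℝ) ^ 2 : ℝ) : ℂ) * nambuPropagator L M β μ h k₁ 1 0) else 0) *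
          (if k₂ = k₄.neg then ((β * (L : ℝ) ^ 2 : ℝ) : ℂ) * nambuPropagator L M β μ h k₂ 0 1 else 0) := by
  by_cases hcons : matsubaraInt M k₁.1 + matsubaraInt M k₃.1 = matsubaraInt M k₂.1 + matsubaraInt M k₄.1 ∧
      k₁.2 + k₃.2 = k₂.2 + k₄.2
  · rw [if_pos hcons, gaussExpect_vertexMonomial]
  · rw [if_neg hcons, map_zero]
    have hAB : (if k₁ = k₂ then -(((β * (L : ℝ) ^ 2 : ℝ) : ℂ) * nambuPropagator L M β μ h k₁ 0 0) else 0) *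
        (if k₃ = k₄ then ((β * (L : ℝ) ^ 2 : ℝ) : ℂ) * nambuPropagator L M β μ h k₃.neg 1 1 else 0) = 0 := by
      by_cases h12 : k₁ = k₂
      · by_cases h34 : k₃ = k₄
        · exfalso; apply hcons; subst h12; subst h34; exact vertexConstraint_of_hartree k₁ k₃
        · rw [if_neg h34, mul_zero]
      · rw [if_neg h12, zero_mul]
    have hCD : (if k₁ = k₃.neg then -(((β * (L : ℝ) ^ 2 : ℝ) : ℂ) * nambuPropagator L M β μ h k₁ 1 0) else 0) *
        (if k₂ = k₄.neg then ((β * (L : ℝ) ^ 2 : ℝ) : ℂ) * nambuPropagator L M β μ h k₂ 0 1 else 0) = 0 := by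
      by_cases h13 : k₁ = k₃.neg
      · by_cases h24 : k₂ = k₄.neg
        · exfalso; apply hcons; subst h13; subst h24; exact vertexConstraint_of_anomalous k₃ k₄
        · rw [if_neg h24, mul_zero]
      · rw [if_neg h13, zero_mul]
    rw [hAB, hCD, sub_zero]

/-- **The truncated Hartree–Fock value of the Hubbard vertex.** For the seeded free covariance with `2M`
Matsubara frequencies, `∫ dμ_C V = U (βL²)⁻¹ [ (Σ_k G₁₁(k)) (−Σ_k G₂₂(k)) + (Σ_k G₂₁(k)) (Σ_k G₁₂(k)) ]`,
`k = (ω, k⃗)` over the kept frequencies and the torus (Hartree term of both spins and the anomalous `F F̄` term;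
no exchange term between opposite spins). [folklore] -/
theorem gaussExpect_hubbardInteraction (U : ℝ) :
    gaussExpect ℂ (hubbardCovariance L M β μ h) (hubbardInteraction L M β U) =
      ((U / (β * (L : ℝ) ^ 2) ^ 3 : ℝ) : ℂ) * ((β * (L : ℝ) ^ 2 : ℝ) : ℂ) ^ 2 *
        (-(∑ k : FreqMomentum L M, nambuPropagator L M β μ h k 0 0) *
            (∑ k : FreqMomentum L M, nambuPropagator L M β μ h k 1 1) +
          (∑ k : FreqMomentum L M, nambuPropagator L M β μ h k 1 0) *
            (∑ k : FreqMomentum L M, nambuPropagator L M β μ h k 0 1)) := by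
  classical
  rw [hubbardInteraction, map_smul, smul_eq_mul]
  simp only [map_sum, gaussExpect_vertexMonomial_ite, Finset.sum_sub_distrib]
  -- the Hartree double sum
  have hA : ∑ k₁ : FreqMomentum L M, ∑ k₂ : FreqMomentum L M, ∑ k₃ : FreqMomentum L M, ∑ k₄ : FreqMomentum L M,
      (if k₁ = k₂ then -(((β * (L : ℝ) ^ 2 : ℝ) : ℂ) * nambuPropagator L M β μ h k₁ 0 0) else 0) *
        (if k₃ = k₄ then ((β * (L : ℝ) ^ 2 : ℝ) : ℂ) * nambuPropagator L M β μ h k₃.neg 1 1 else 0) =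
      (∑ k : FreqMomentum L M, -(((β * (L : ℝ) ^ 2 : ℝ) : ℂ) * nambuPropagator L M β μ h k 0 0)) *
        ∑ k : FreqMomentum L M, ((β * (L : ℝ) ^ 2 : ℝ) : ℂ) * nambuPropagator L M β μ h k 1 1 := by
    simp only [← Finset.mul_sum, Finset.sum_ite_eq, Finset.mem_univ, if_true, ← Finset.sum_mul]
    rw [sum_freqMomentum_neg (fun k => nambuPropagator L M β μ h k 1 1)]
  -- the anomalous double sum
  have hB : ∑ k₁ : FreqMomentum L M, ∑ k₂ : FreqMomentum L M, ∑ k₃ : FreqMomentum L M, ∑ k₄ : FreqMomentum L M,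
      (if k₁ = k₃.neg then -(((β * (L : ℝ) ^ 2 : ℝ) : ℂ) * nambuPropagator L M β μ h k₁ 1 0) else 0) *
        (if k₂ = k₄.neg then ((β * (L : ℝ) ^ 2 : ℝ) : ℂ) * nambuPropagator L M β μ h k₂ 0 1 else 0) =
      (∑ k : FreqMomentum L M, -(((β * (L : ℝ) ^ 2 : ℝ) : ℂ) * nambuPropagator L M β μ h k 1 0)) *
        ∑ k : FreqMomentum L M, ((β * (L : ℝ) ^ 2 : ℝ) : ℂ) * nambuPropagator L M β μ h k 0 1 := by
    calc _ = ∑ k₁ : FreqMomentum L M, ∑ k₂ : FreqMomentum L M,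
          (∑ k₃ : FreqMomentum L M,
              (if k₁ = k₃.neg then -(((β * (L : ℝ) ^ 2 : ℝ) : ℂ) * nambuPropagator L M β μ h k₁ 1 0) else 0)) *
            ∑ k₄ : FreqMomentum L M,
              (if k₂ = k₄.neg then ((β * (L : ℝ) ^ 2 : ℝ) : ℂ) * nambuPropagator L M β μ h k₂ 0 1 else 0) := by
          refine Finset.sum_congr rfl fun k₁ _ => Finset.sum_congr rfl fun k₂ _ => ?_
          rw [Finset.sum_mul_sum]
      _ = ∑ k₁ : FreqMomentum L M, ∑ k₂ : FreqMomentum L M,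
          -(((β * (L : ℝ) ^ 2 : ℝ) : ℂ) * nambuPropagator L M β μ h k₁ 1 0) *
            (((β * (L : ℝ) ^ 2 : ℝ) : ℂ) * nambuPropagator L M β μ h k₂ 0 1) := by
          simp only [sum_ite_eq_neg]
      _ = _ := by rw [Finset.sum_mul_sum]
  rw [hA, hB]
  simp only [Finset.sum_neg_distrib, ← Finset.mul_sum]
  ring


/-! ### Without seed: the Hartree term and its `M → ∞` limit (the midpoint density `n_F − ½`) -/

omit [NeZero L] in
/-- At `h = 0` the anomalous entries of the Nambu propagator vanish (`G₁₂`). [folklore] -/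
@[simp] theorem nambuPropagator_zero_seed_01 (k : FreqMomentum L M) : nambuPropagator L M β μ 0 k 0 1 = 0 := by
  simp [nambuPropagator]

omit [NeZero L] in
/-- At `h = 0` the anomalous entries of the Nambu propagator vanish (`G₂₁`). [folklore] -/
@[simp] theorem nambuPropagator_zero_seed_10 (k : FreqMomentum L M) : nambuPropagator L M β μ 0 k 1 0 = 0 := by
  simp [nambuPropagator]

omit [NeZero L] in
/-- The diagonal entries, unfolded. [folklore] -/
theorem nambuPropagator_apply_00 (k : FreqMomentum L M) :
    nambuPropagator L M β μ h k 0 0 = (Complex.I * matsubaraFreq β M k.1 + nambuXi L μ k.2) / nambuDen L M β μ h k := by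
  simp [nambuPropagator]

omit [NeZero L] in
/-- The diagonal entries, unfolded. [folklore] -/
theorem nambuPropagator_apply_11 (k : FreqMomentum L M) :
    nambuPropagator L M β μ h k 1 1 = (Complex.I * matsubaraFreq β M k.1 - nambuXi L μ k.2) / nambuDen L M β μ h k := by
  simp [nambuPropagator]

/-- **`Σ_k G₂₂(k) = −Σ_k G₁₁(k)`** on the symmetric frequency set (`ω ↦ −ω`; any seed). [folklore] -/
theorem sum_nambuPropagator_11 :
    ∑ k : FreqMomentum L M, nambuPropagator L M β μ h k 1 1 = -∑ k : FreqMomentum L M, nambuPropagator L M β μ h k 0 0 := by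
  rw [Fintype.sum_prod_type, Fintype.sum_prod_type]
  -- reflect the (outer) frequency sum
  have hrefl := sum_matsubaraIdx_reflect β M
    (fun ω => ∑ q : TorusSite 2 L,
      (Complex.I * ω - nambuXi L μ q) / ((ω ^ 2 + nambuXi L μ q ^ 2 + (h * dWaveSymbol L q) ^ 2 : ℝ) : ℂ))
  simp only [nambuPropagator_apply_11, nambuPropagator_apply_00, nambuDen]
  rw [hrefl, ← Finset.sum_neg_distrib]
  refine Finset.sum_congr rfl fun i _ => ?_
  rw [← Finset.sum_neg_distrib]
  refine Finset.sum_congr rfl fun q _ => ?_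
  rw [neg_sq, ← neg_div]
  congr 1
  push_cast
  ring

/-- **The Hartree term without seed**: `∫ dμ_C V = U (βL²)⁻¹ (Σ_k 1/(−iω_k + ξ_k))²` (`h = 0`, `β ≠ 0`).
[folklore] -/
theorem gaussExpect_hubbardInteraction_zero_seed {β : ℝ} (hβ : β ≠ 0) (μ U : ℝ) :
    gaussExpect ℂ (hubbardCovariance L M β μ 0) (hubbardInteraction L M β U) =
      ((U / (β * (L : ℝ) ^ 2) : ℝ) : ℂ) *
        (∑ k : FreqMomentum L M, (1 : ℂ) / (-(Complex.I * matsubaraFreq β M k.1) + nambuXi L μ k.2)) ^ 2 := by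
  rw [gaussExpect_hubbardInteraction, sum_nambuPropagator_11]
  simp only [nambuPropagator_zero_seed_01, nambuPropagator_zero_seed_10, Finset.sum_const_zero, mul_zero, add_zero,
    nambuPropagator_zero_seed L M hβ, neg_mul]
  have hL : (L : ℂ) ≠ 0 := by exact_mod_cast NeZero.ne L
  have hβ' : (β : ℂ) ≠ 0 := by exact_mod_cast hβ
  push_cast
  field_simp

/-- **The truncated Hartree energy density tends to that of the SYMMETRISED interaction.** At `h = 0`, `β > 0`:
`(βL²)⁻¹ ∫ dμ_{C_M} V ⟶ U · (L⁻² Σ_{k⃗} (½ − n_F(ξ_{k⃗})))²` as `M → ∞` — by `tendsto_truncatedTadpole_bgm` each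
frequency sum carries the MIDPOINT value `½ − n_F`, so the first-order (Hartree) free energy of the tree's Grassmann
representation is that of `U Σ_x (n_{x↑} − ½)(n_{x↓} − ½)` in the free state (`U(n − ½)²` per site, `n` the free density
per spin), not that of `U Σ_x n_{x↑}n_{x↓}` (`U n²`): the plain quartic vertex with the symmetric Matsubara truncation
realises the Hubbard interaction at operator chemical potential `μ + U/2` (Giuliani–Mastropietro 2010, (2.6) and App. A).
[cite: GiulianiMastropietro2010, App. A (A.19)–(A.21)] -/
theorem tendsto_gaussExpect_hubbardInteraction_zero_seed {β : ℝ} (hβ : 0 < β) (μ U : ℝ) :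
    Tendsto (fun M : ℕ => (1 / ((β * (L : ℝ) ^ 2 : ℝ) : ℂ)) *
        gaussExpect ℂ (hubbardCovariance L M β μ 0) (hubbardInteraction L M β U)) atTop
      (𝓝 ((U : ℂ) * ((1 / ((L : ℝ) ^ 2 : ℝ) : ℂ) *
          ∑ q : TorusSite 2 L, ((1 / 2 - (1 + Real.exp (β * nambuXi L μ q))⁻¹ : ℝ) : ℂ)) ^ 2)) := by
  have hL : (L : ℂ) ≠ 0 := by exact_mod_cast NeZero.ne L
  have hβ' : (β : ℂ) ≠ 0 := by exact_mod_cast hβ.ne'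
  -- closed form at each `M`
  have hform : ∀ M : ℕ, (1 / ((β * (L : ℝ) ^ 2 : ℝ) : ℂ)) *
      gaussExpect ℂ (hubbardCovariance L M β μ 0) (hubbardInteraction L M β U) =
      (U : ℂ) * ((1 / ((L : ℝ) ^ 2 : ℝ) : ℂ) * ∑ q : TorusSite 2 L,
        (1 / (β : ℂ)) * ∑ i : MatsubaraIdx M, (1 : ℂ) / (-(Complex.I * matsubaraFreq β M i) + nambuXi L μ q)) ^ 2 := by
    intro M
    rw [gaussExpect_hubbardInteraction_zero_seed hβ.ne', Fintype.sum_prod_type, Finset.sum_comm]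
    simp only [← Finset.mul_sum]
    push_cast
    field_simp
  simp_rw [hform]
  refine ((tendsto_finsetSum _ fun q _ => tendsto_truncatedTadpole_bgm hβ (nambuXi L μ q)).const_mul _).pow 2
    |>.const_mul _

end TruncatedHartree

end Literature.MathematicalPhysics.QuantumLattice
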